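import Summits.QuantumFields.YangMills.Theorems.InfiniteVolumeContinuumOSExistenceOn
import HarnessLib

/-!
# Route `InfiniteVolumeContinuum` (target stmt-QuantumFields-19927): the GAP-FREE, ROTATION-FREE leaf — OS0, E0′, E2,
# E3, translations, HYPEROCTAHEDRAL invariance, NT, NG of the infinite-volume-first continuum data from `UV ∧ UVSeamRec`

Seat `ym-infvol-p1` (R136 (i)).  HONEST FRAMING: existence half only and LESS than the route's current target: full
Euclidean invariance E1 is NOT concluded here (it needs the spine's rotation crux `ROT`, which in its rev-2′ shape is
guarded by the infrared leg — see `InfiniteVolumeContinuumOSExistenceOfLegsOn.lean`); what IS concluded is the exact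
lattice symmetry content, the hyperoctahedral group (signed permutations of the axes) on `⁰𝒮`, plus OS0, E0′, E2, E3,
translations, NT and NG.  Hypotheses: the floors `LowerBounds G r a` and the ceilings `MomentBounds6 G r a` (the outputs of the spine's
`UVSeamRec`, OPEN); no `IR`, no `ROT`.  No clustering, no mass gap, not Clay.

WHY (this seat's memo `R85-ROT-IMPACT-infvol.md`, evidence #2 on 19927, options (iii′)∕(iv)).  If the planner re-types
the route's leaf WITHOUT E1 when `ROT` becomes IR-guarded, the honest maximal symmetry clause the lattice supplies for
free is hyperoctahedral invariance (seat p3's `stub_ivSigned` ∕ seat p2's `exists_ivDataOn_onSides_rp`).  THIS FILE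
pre-certifies that leaf: its text is `OSExistenceFromInfiniteVolume` with the conjunct `S₁.toLabelled.IsEuclideanInvariant`
replaced by `∀ n R, (R a signed permutation of the axes) → ∀ F ∈ ⁰𝒮ₙ, S₁ n (linActMulti R F) = S₁ n F`, reached from
floors and ceilings alone.

* `osExistenceHyperData_of_floors_ceilings` — for every compact `G`, `r`, positive unit `a → 0` with `LowerBounds G r a`
  and `MomentBounds6 G r a`: the leaf's data (p2's class package on the odd class + `nt_ng_of_data`).
* The composition against the spine's legs BY NAME, `osExistenceIVHyper_of_legs : UV → UVSeamRec → (the hyperoctahedral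
  leaf, text inline)` (a candidate deciding theorem for option (iii′)∕(iv): two alias cruxes, zero supports), is
  appended to `Theorems/InfiniteVolumeContinuumOSExistenceOfLegsOn.lean` (the module that imports the spine's route
  file); this module stays route-file-free.

References: K. Osterwalder, R. Schrader, CMP 31 (1973), CMP 42 (1975); J. Glimm, A. Jaffe, Quantum Physics (1987)
§6.1; S. Chatterjee, arXiv:1803.01950 §2.
-/

set_option autoImplicit false

noncomputable section

open MeasureTheory Filter Topology
open scoped BigOperators SchwartzMap
open Literature.MathematicalPhysics.QuantumFieldTheory hiding ZdEdge
open Literature.MathematicalPhysics.QuantumLattice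
open Literature.MathematicalPhysics.AQFT
open Summit.QuantumFields.YangMills.Cruxes.OSLegsFromFemtoAndGap.DlrCollarTransfer
open Summit.QuantumFields.YangMills.Theorems.ROT (UnboundedClass)
open Summit.QuantumFields.YangMills.Theorems.InfiniteVolume

namespace Summit.QuantumFields.YangMills.Theorems.InfiniteVolumeContinuum

variable {G : Type} [Group G] [TopologicalSpace G] [IsTopologicalGroup G] [CompactSpace G]
  [MeasurableSpace G] [BorelSpace G]

/-- **The hyperoctahedral leaf's data from floors and ceilings alone.**  For every compact `G`, lattice representation
`r` and positive unit `a → 0` with `LowerBounds G r a` and `MomentBounds6 G r a`: couplings `β_k → ∞`, odd-torus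
limit states, a one-field family and plane-string limits with the DATA clause, E0, hermiticity, E0′, invariance under
all signed permutations of the axes on `⁰𝒮`, E2, E3, translation invariance, NT and NG.  No rotation leg, no gap.
(Seat p2's `exists_ivDataOn_onSides_rp` on the odd raw sides + `nt_ng_of_data`.) [folklore] -/
theorem osExistenceHyperData_of_floors_ceilings (r : LatticeRep G) {a : ℝ → ℝ} (hapos : ∀ b, 0 < a b)
    (ha0 : Tendsto a atTop (𝓝 0)) (hLB : LowerBounds G r a) (hMB : MomentBounds6 G r a) :
    ∃ (β : ℕ → ℝ) (μ : ℕ → Measure (LGConfig 4 G)) (S₁ : SchwingerFamily (EuclideanSpace ℝ (Fin 4))) (T : (n : ℕ) → (Fin n → Fin 4 × Fin 4) → (SchwartzMap (Fin n → EuclideanSpace ℝ (Fin 4)) ℂ →L[ℂ] ℂ)), (Filter.Tendsto β Filter.atTop Filter.atTop ∧ (∀ k, μ k ∈ oddTorusLimitPoints r (β k)) ∧ (∀ F : SchwartzMap (Fin 0 → EuclideanSpace ℝ (Fin 4)) ℂ, S₁ 0 F = F default) ∧ (∀ F : SchwartzMap (Fin 1 → EuclideanSpace ℝ (Fin 4))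 ℂ, S₁ 1 F = 0) ∧ (∀ n : ℕ, 2 ≤ n → ∀ F : SchwartzMap (Fin n → EuclideanSpace ℝ (Fin 4)) ℂ, S₁ n F = ∑ q ∈ Fintype.piFinset (fun _ : Fin n => Finset.univ.filter fun p : Fin 4 × Fin 4 => p.1 < p.2), T n q F) ∧ (∀ n : ℕ, 2 ≤ n → ∀ q : Fin n → Fin 4 × Fin 4, (∀ i, (q i).1 < (q i).2) → ∀ F : SchwartzMap (Fin n → EuclideanSpace ℝ (Fin 4)) ℂ, IsOffDiagonal F → Filter.Tendsto (fun k => ∑' x : Fin n → (Fin 4 → ℤ), ((stateMomentStr G r (μ k) n q x : ℝ) : ℂ) * F (fun l => a (β k) • siteToE (x l) + (a (β k) / 2) • (EuclideanSpace.single (q l).1 (1 : ℝ) + EuclideanSpace.single (q l).2 (1 : ℝ)))) Filter.atTop (nhds (T n q F)))) ∧ S₁.toLabelled.IsNormalized ∧ S₁.toLabelled.IsHermitian ∧ S₁.toLabelled.HasLinearGrowth ∧ (∀ (n : ℕ) (R : EuclideanSpace ℝ (Fin 4) ≃ₗᵢ[ℝ] EuclideanSpace ℝ (Fin 4)), (∀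 i : Fin 4, ∃ j : Fin 4, R (EuclideanSpace.single i 1) = EuclideanSpace.single j 1 ∨ R (EuclideanSpace.single i 1) = -EuclideanSpace.single j 1) → ∀ F : SchwartzMap (Fin n → EuclideanSpace ℝ (Fin 4)) ℂ, IsOffDiagonal F → S₁ n (linActMulti R F) = S₁ n F) ∧ S₁.toLabelled.IsReflectionPositive ∧ S₁.toLabelled.IsSymmetric ∧ (∀ (n : ℕ) (t : EuclideanSpace ℝ (Fin 4)) (F : SchwartzMap (Fin n → EuclideanSpace ℝ (Fin 4)) ℂ), IsOffDiagonal F → S₁ n (translateMulti t F) = S₁ n F) ∧ (∃ (F₁ G₁ : SchwartzMap (Fin 1 → EuclideanSpace ℝ (Fin 4)) ℂ) (H₁ : SchwartzMap (Fin (1 + 1) → EuclideanSpace ℝ (Fin 4)) ℂ), IsTimeOrdered F₁ ∧ IsTimeOrdered G₁ ∧ IsAppendTensorOf H₁ (osAdjoint F₁) G₁ ∧ S₁.toLabelled (1 + 1) (fun _ => ()) H₁ ≠ S₁.toLabelled 1 (fun _ => ()) (osAdjoint F₁) * S₁.toLabelled 1 (fun _ => ()) G₁) ∧ (∃ (f g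 h : SchwartzMap (EuclideanSpace ℝ (Fin 4)) ℂ) (Ffgh : SchwartzMap (Fin 3 → EuclideanSpace ℝ (Fin 4)) ℂ) (Fgh Ffh Ffg : SchwartzMap (Fin 2 → EuclideanSpace ℝ (Fin 4)) ℂ) (Ff Fg Fh : SchwartzMap (Fin 1 → EuclideanSpace ℝ (Fin 4)) ℂ), IsTensorOf Ffgh ![f, g, h] ∧ IsOffDiagonal Ffgh ∧ IsTensorOf Fgh ![g, h] ∧ IsTensorOf Ffh ![f, h] ∧ IsTensorOf Ffg ![f, g] ∧ IsTensorOf Ff ![f] ∧ IsTensorOf Fg ![g] ∧ IsTensorOf Fh ![h] ∧ S₁.toLabelled 3 (fun _ => ()) Ffgh - S₁.toLabelled 1 (fun _ => ()) Ff * S₁.toLabelled 2 (fun _ => ()) Fgh - S₁.toLabelled 1 (fun _ => ()) Fg * S₁.toLabelled 2 (fun _ => ()) Ffh - S₁.toLabelled 1 (fun _ => ()) Fh * S₁.toLabelled 2 (fun _ => ()) Ffg + 2 * (S₁.toLabelled 1 (fun _ => ()) Ff * S₁.toLabelled 1 (fun _ => ()) Fg * S₁.toLabelled 1 (fun _ =>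 ()) Fh) ≠ 0) := by
  classical
  have hU : UnboundedClass (Set.univ : Set ℕ) := fun N => ⟨N, Set.mem_univ _, le_rfl⟩
  obtain ⟨β, N, μ, S₁, T, hβ, hN, hNS, hμN, h0, h1, hS, hT, hE0, hherm, hLG, hRP, hE2, hE3, htr, hsigned, -⟩ :=
    exists_ivDataOn_onSides_rp r hapos ha0 (momentBounds6OnSides_oddClass r a Set.univ hMB) (oddClass_unbounded hU)
  obtain ⟨N', hN', -, hNN'⟩ := exists_halfSides_of_oddClass hN hNS
  have hμodd : ∀ k, μ k ∈ oddTorusLimitPoints r (β k) := fun k => ⟨N', hN', by rw [hNN']; exact hμN k⟩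
  obtain ⟨hNT, hNG⟩ := nt_ng_of_data r hapos ha0 hLB hMB β μ S₁ T hβ hμodd h1 hS hT
  exact ⟨β, μ, S₁, T, ⟨hβ, hμodd, h0, h1, hS, hT⟩, hE0, hherm, hLG, fun n R hR F hF => hsigned R hR n F hF, hE2, hE3,
    htr, hNT, hNG⟩

end Summit.QuantumFields.YangMills.Theorems.InfiniteVolumeContinuum

end
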